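import Mathlib
import HarnessLib
import Summits.NavierStokesRegularity.NavierStokesRegularity.Theorems.PoloidalWindowDoorPoloidalWindowRigidityPressureOscillation
import Summits.NavierStokesRegularity.NavierStokesRegularity.Theorems.PoloidalWindowDoorPoloidalWindowRigidityLargeScaleEnergyPressureOscillationTwo

/-!
# Route `PoloidalWindowDoor`, crux `PoloidalWindowRigidity` (K2, stmt-NavierStokesRegularity-19708) — whole-class tool:
# THE `L²` MEAN-OSCILLATION BOUND FOR THE CLASS PRESSURE on balls of radius `≥ 1` (exponent-`2` form of nsreg-p7 g6's
# (F1); twin of `…LargeScaleEnergyPressure32`, feeding the floor `α > 1` of the energy bootstrap)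

Cell ns-regularity-ideate, seat ns-poloidal-K2-p3 gen 3 (stub-worker under the K2 lead; file landed
`--supports stmt-NavierStokesRegularity-19708` as a helper).

* `setIntegral_rpow_two_le_of_lintegral_rpow_le` — bookkeeping `∫⁻_{B} ‖f‖ₑ² ≤ ofReal(Y|B|)` ⇒ `∫_{B̄} |f|² ≤ Y|B̄|`;
* `exists_integral_rpow_two_sub_le_class` — **∃ universal `A₀ ≥ 0`: for every profile of the Type-I mild class
  (rate `C`, Oseen-mild), every classical pressure `p` on `(t₀,0)`, every `s ∈ (t₀,0)`, centre `x₀`, radius `r ≥ 1`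
  there is `κ` with `∫_{B̄(x₀,r)} |p(s) − κ|² ≤ (A₀C²/(−s))² · |B̄(x₀,r)|`** (p7 g6's `sliceFunctional_eq_zero_class`
  fed to the `L²` slice estimate `slice_pressure_oscillation_le_two`; near field `≤ CN²M⁴|B_{4r}|`, far field
  `≤ (CK·I₁/2)²M⁴|B_r|`, `M = C/√(−s)`).

WHAT THIS IS NOT: not a claim about Navier–Stokes regularity and not the open residue S2⁗ — potential theory of one
time slice of the class (bears_on LADDER-NS N0 via crux K2 = stmt-19708; whole-class tool).
-/

noncomputable section

-- the summit and its single sub-problem share the name (CONVENTIONS §1), as in every Theorems file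
set_option linter.dupNamespace false

-- nested operator types `ℝ³ →L[ℝ] ℝ³ →L[ℝ] ℝ³ →L[ℝ] ℝ`
set_option maxSynthPendingDepth 3

namespace Summit.NavierStokesRegularity.NavierStokesRegularity.Theorems.PoloidalWindowDoorPoloidalWindowRigidityLargeScaleEnergyPressureTwo

open MeasureTheory Set Function Filter Topology Metric InnerProductSpace
open scoped RealInnerProductSpace ENNReal NNReal Laplacian ContDiff
open Literature.Analysis Literature.Analysis.FluidPDE Literature.Analysis.UnboundedOperators
open Summit.NavierStokesRegularity.NavierStokesRegularity.Theorems.PoloidalWindowDoorPoloidalWindowRigidityPressureGradientIdentity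
  (lintegral_ball_le_of_bound)
open Summit.NavierStokesRegularity.NavierStokesRegularity.Theorems.PoloidalWindowDoorPoloidalWindowRigidityPressureOscillation
  (sliceFunctional_eq_zero_class)
open Summit.NavierStokesRegularity.NavierStokesRegularity.Theorems.PoloidalWindowDoorPoloidalWindowRigidityLargeScaleEnergyPressureOscillationTwo
  (slice_pressure_oscillation_le_two)

/-! ## From the `lintegral` form to the Bochner form on the closed ball -/

/-- **Bookkeeping.** For a continuous `f` and `Y ≥ 0`: `∫⁻_{B(x₀,r)} ‖f‖ₑ² ≤ ofReal(Y · |B(x₀,r)|)` implies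
`∫_{B̄(x₀,r)} |f|² ≤ Y · |B̄(x₀,r)|` (rpow exponents; the sphere is null). [folklore] -/
theorem setIntegral_rpow_two_le_of_lintegral_rpow_le {f : EuclideanSpace ℝ (Fin 3) → ℝ} (hf : Continuous f)
    (x₀ : EuclideanSpace ℝ (Fin 3)) {r Y : ℝ} (hY : 0 ≤ Y)
    (h : ∫⁻ c in ball x₀ r, ‖f c‖ₑ ^ (2 : ℝ) ≤ ENNReal.ofReal (Y * volume.real (ball x₀ r))) :
    ∫ c in closedBall x₀ r, |f c| ^ (2 : ℝ) ≤ Y * volume.real (closedBall x₀ r) := by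
  set μ : Measure (EuclideanSpace ℝ (Fin 3)) := volume.restrict (ball x₀ r) with hμ
  haveI : IsFiniteMeasure μ := ⟨by rw [hμ, Measure.restrict_apply_univ]; exact measure_ball_lt_top⟩
  set V : ℝ := volume.real (ball x₀ r) with hV
  have hV0 : 0 ≤ V := measureReal_nonneg
  obtain ⟨B, hB⟩ : ∃ B, ∀ y ∈ closedBall x₀ r, ‖f y‖ ≤ B :=
    (isCompact_closedBall x₀ r).exists_bound_of_continuousOn hf.continuousOn
  have hfm : MemLp (fun c => |f c|) (ENNReal.ofReal 2) μ := by
    refine MemLp.of_bound (hf.abs.aestronglyMeasurable) (max B 0) ?_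
    rw [hμ]
    filter_upwards [ae_restrict_mem measurableSet_ball] with y hy
    rw [Real.norm_eq_abs, abs_abs]
    exact ((Real.norm_eq_abs _).symm.le.trans (hB y (ball_subset_closedBall hy))).trans (le_max_left _ _)
  have hint : Integrable (fun c => |f c| ^ (2 : ℝ)) μ := by
    have h32 := hfm.integrable_norm_rpow (by simp) (by simp)
    refine h32.congr (Eventually.of_forall fun c => ?_)
    dsimp only
    rw [Real.norm_eq_abs, abs_abs, ENNReal.toReal_ofReal (by norm_num : (0 : ℝ) ≤ 2)]
  have hreal : ∫ c, |f c| ^ (2 : ℝ) ∂μ ≤ Y * V := by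
    have h1 : ENNReal.ofReal (∫ c, |f c| ^ (2 : ℝ) ∂μ) = ∫⁻ c, ‖f c‖ₑ ^ (2 : ℝ) ∂μ := by
      rw [ofReal_integral_eq_lintegral_ofReal hint (Eventually.of_forall fun c => by positivity)]
      refine lintegral_congr fun c => ?_
      rw [← ofReal_norm, Real.norm_eq_abs, ENNReal.ofReal_rpow_of_nonneg (abs_nonneg _) (by norm_num)]
    have h2 : ENNReal.ofReal (∫ c, |f c| ^ (2 : ℝ) ∂μ) ≤ ENNReal.ofReal (Y * V) := by rw [h1]; exact h
    exact (ENNReal.ofReal_le_ofReal_iff (by positivity)).1 h2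
  rw [setIntegral_congr_set (closedBall_ae_eq_ball_three x₀ r),
    show volume.real (closedBall x₀ r) = volume.real (ball x₀ r) by
      rw [measureReal_def, measureReal_def, Measure.addHaar_closedBall_eq_addHaar_ball]]
  exact hreal

/-! ## The `L²` oscillation bound for the class pressure -/

/-- **THE `L²` MEAN-OSCILLATION BOUND FOR THE CLASS PRESSURE** (exponent-`2` form of (F1)).  There is a universal
`A₀ ≥ 0` such that for every profile of the route's Type-I class (rate `C`, Oseen-mild between negative times), every
classical pressure `p` on a window `(t₀,0)`, every `s ∈ (t₀,0)`, every centre `x₀` and radius `r ≥ 1` one finds `κ`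
with `∫_{B̄(x₀,r)} |p(s,x) − κ|² dx ≤ (A₀·C²/(−s))² · |B̄(x₀,r)|`. [folklore] -/
theorem exists_integral_rpow_two_sub_le_class :
    ∃ A₀ : ℝ, 0 ≤ A₀ ∧ ∀ {C : ℝ} {v : ℝ → EuclideanSpace ℝ (Fin 3) → EuclideanSpace ℝ (Fin 3)}
      {p : ℝ → EuclideanSpace ℝ (Fin 3) → ℝ} {t₀ : ℝ},
      HasTypeITimeDecay C v →
      (∀ s t : ℝ, s < t → t < 0 → ∀ x,
        v t x = heatExtension (v s) (t - s) x - oseenDuhamel 1 s v v t x) →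
      t₀ < 0 → IsClassicalNSSolutionOn (Ioo t₀ 0) 1 0 v p →
      ∀ s ∈ Ioo t₀ 0, ∀ (x₀ : EuclideanSpace ℝ (Fin 3)) (r : ℝ), 1 ≤ r →
        ∃ κ : ℝ, ∫ x in closedBall x₀ r, |p s x - κ| ^ (2 : ℝ) ≤
          (A₀ * C ^ 2 / (-s)) ^ (2 : ℝ) * volume.real (closedBall x₀ r) := by
  obtain ⟨CN, CK, hCK0, H⟩ := slice_pressure_oscillation_le_two
  -- the tail mass `I₁ = ∫_{|z| ≥ 1} |z|⁻⁴`
  set I₁ : ℝ := (∫⁻ u in (ball (0 : EuclideanSpace ℝ (Fin 3)) 1)ᶜ, RieszKernel.powKer 4 u).toReal with hI₁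
  have hI₁0 : 0 ≤ I₁ := ENNReal.toReal_nonneg
  -- p7 g6's universal constant and its `2/3` power
  set K₁ : ℝ := (2 : ℝ) * ((CN : ℝ) ^ (2 : ℝ) * 64 + (CK * I₁ / 2) ^ (2 : ℝ)) with hK₁
  have hK₁0 : 0 ≤ K₁ := by positivity
  refine ⟨K₁ ^ (1 / 2 : ℝ), by positivity, ?_⟩
  intro C v p t₀ hrate hmild ht₀ hcl s hs x₀ r hr
  have hr0 : 0 < r := by linarith
  have hs0 : 0 < -s := by linarith [hs.2]
  have hC0 : 0 ≤ C := by
    have h := hrate (-1) (by norm_num) 0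
    rw [neg_neg, Real.sqrt_one, div_one] at h
    exact (norm_nonneg _).trans h
  -- the slice and its Type-I bound
  set M : ℝ := C / Real.sqrt (-s) with hM
  have hM0 : 0 ≤ M := div_nonneg hC0 (Real.sqrt_nonneg _)
  have hMb : ∀ y, ‖v s y‖ ≤ M := fun y => hrate s hs.2 y
  have hM2 : M ^ 2 = C ^ 2 / (-s) := by rw [hM, div_pow, Real.sq_sqrt hs0.le]
  have hvc : Continuous (v s) := (hcl.contDiff_velocity hs).continuous
  have hpc : Continuous (p s) := (hcl.contDiff_pressure hs).continuous
  have hvm : AEStronglyMeasurable (v s) volume := hvc.aestronglyMeasurable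
  set A : ℝ≥0∞ := ENNReal.ofReal (M ^ 2) * volume (ball (0 : EuclideanSpace ℝ (Fin 3)) 1) with hA
  have hAtop : A ≠ ⊤ := ENNReal.mul_ne_top ENNReal.ofReal_ne_top measure_ball_lt_top.ne
  have hAb : ∀ z : EuclideanSpace ℝ (Fin 3), ∫⁻ y in ball z 1, ‖v s y‖ₑ ^ 2 ≤ A := lintegral_ball_le_of_bound hMb
  have hid : ∀ (n : ℕ) (c e : EuclideanSpace ℝ (Fin 3)),
      ∫ x, (p s x * fderiv ℝ (Δ (newtonReg ((n : ℝ) + 1)⁻¹)) (c - x) e +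
        evalDiag (v s x) (fderiv ℝ (fderiv ℝ (fderiv ℝ (newtonReg ((n : ℝ) + 1)⁻¹))) (c - x) e)) = 0 :=
    fun n c e => sliceFunctional_eq_zero_class hrate hmild hcl hs (by positivity) c e
  obtain ⟨κ, hκ⟩ := H (v s) A (p s) hvm hAtop hAb hpc.locallyIntegrable hid x₀ r hr0
  refine ⟨κ, ?_⟩
  -- volumes
  set V₁ : ℝ≥0∞ := volume (ball (0 : EuclideanSpace ℝ (Fin 3)) 1) with hV₁
  have hvol : ∀ (z : EuclideanSpace ℝ (Fin 3)) (ρ : ℝ), 0 < ρ →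
      volume (ball z ρ) = ENNReal.ofReal (ρ ^ 3) * V₁ := by
    intro z ρ hρ
    rw [Measure.addHaar_ball volume z hρ.le, finrank_euclideanSpace_fin, hV₁]
  have hρ : 0 < 2 * (r + 1) := by positivity
  have hρ4 : 2 * (r + 1) ≤ 4 * r := by linarith
  -- the near term
  have hI3 : ∫⁻ y in ball x₀ (2 * (r + 1)), ‖v s y‖ₑ ^ (4 : ℕ) ≤ ENNReal.ofReal (M ^ 4 * (64 * r ^ 3)) * V₁ := by
    calc ∫⁻ y in ball x₀ (2 * (r + 1)), ‖v s y‖ₑ ^ (4 : ℕ)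
        ≤ ∫⁻ y in ball x₀ (2 * (r + 1)), ENNReal.ofReal (M ^ 4) := by
          refine lintegral_mono fun y => ?_
          rw [← ofReal_norm, ← ENNReal.ofReal_pow (norm_nonneg _)]
          exact ENNReal.ofReal_le_ofReal (pow_le_pow_left₀ (norm_nonneg _) (hMb y) 4)
      _ = ENNReal.ofReal (M ^ 4) * volume (ball x₀ (2 * (r + 1))) := setLIntegral_const _ _
      _ ≤ ENNReal.ofReal (M ^ 4) * volume (ball x₀ (4 * r)) := by gcongr
      _ = ENNReal.ofReal (M ^ 4 * (64 * r ^ 3)) * V₁ := by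
          rw [hvol x₀ (4 * r) (by positivity), ← mul_assoc, ← ENNReal.ofReal_mul (by positivity)]
          ring_nf
  -- the far term
  have hfar : ENNReal.ofReal (CK * (r + 1)) *
      ∫⁻ y in (ball x₀ (2 * (r + 1)))ᶜ, ‖v s y‖ₑ ^ (2 : ℕ) * RieszKernel.powKer 4 (y - x₀) ≤
        ENNReal.ofReal (CK * I₁ / 2 * M ^ 2) := by
    have h1 : ∫⁻ y in (ball x₀ (2 * (r + 1)))ᶜ, ‖v s y‖ₑ ^ (2 : ℕ) * RieszKernel.powKer 4 (y - x₀) ≤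
        ENNReal.ofReal (M ^ 2) * ∫⁻ y in (ball x₀ (2 * (r + 1)))ᶜ, RieszKernel.powKer 4 (y - x₀) := by
      rw [← lintegral_const_mul' _ _ ENNReal.ofReal_ne_top]
      refine lintegral_mono fun y => ?_
      gcongr
      rw [← ofReal_norm, ← ENNReal.ofReal_pow (norm_nonneg _)]
      exact ENNReal.ofReal_le_ofReal (pow_le_pow_left₀ (norm_nonneg _) (hMb y) 2)
    rw [JiaSverak2014.lintegral_compl_ball_powKer_four_translate x₀ hρ] at h1
    calc _ ≤ ENNReal.ofReal (CK * (r + 1)) * (ENNReal.ofReal (M ^ 2) * ENNReal.ofReal ((2 * (r + 1))⁻¹ * I₁)) := by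
          gcongr
      _ = ENNReal.ofReal (CK * I₁ / 2 * M ^ 2) := by
          rw [← ENNReal.ofReal_mul (by positivity), ← ENNReal.ofReal_mul (by positivity)]
          congr 1
          field_simp
  have hfar32 : (ENNReal.ofReal (CK * (r + 1)) *
      ∫⁻ y in (ball x₀ (2 * (r + 1)))ᶜ, ‖v s y‖ₑ ^ (2 : ℕ) * RieszKernel.powKer 4 (y - x₀)) ^ (2 : ℝ) ≤
        ENNReal.ofReal ((CK * I₁ / 2) ^ (2 : ℝ) * M ^ 4) := by
    refine (ENNReal.rpow_le_rpow hfar (by norm_num)).trans (le_of_eq ?_)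
    rw [ENNReal.ofReal_rpow_of_nonneg (by positivity) (by norm_num), Real.mul_rpow (by positivity) (by positivity)]
    congr 2
    rw [show M ^ 2 = M ^ (2 : ℝ) by norm_cast, ← Real.rpow_mul hM0]
    norm_num
  -- the oscillation bound in `L²`
  have h32 : ∫⁻ c in ball x₀ r, ‖p s c - κ‖ₑ ^ (2 : ℝ) ≤
      ENNReal.ofReal (K₁ * M ^ 4 * volume.real (ball x₀ r)) := by
    refine hκ.trans ?_
    have hVr : volume (ball x₀ r) = ENNReal.ofReal (r ^ 3) * V₁ := hvol x₀ r hr0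
    have hV₁top : V₁ ≠ ⊤ := measure_ball_lt_top.ne
    have hVreal : volume.real (ball x₀ r) = r ^ 3 * V₁.toReal := by
      rw [measureReal_def, hVr, ENNReal.toReal_mul, ENNReal.toReal_ofReal (by positivity)]
    have eCN : (CN : ℝ≥0∞) ^ (2 : ℝ) = ENNReal.ofReal ((CN : ℝ) ^ (2 : ℝ)) := by
      rw [← ENNReal.ofReal_coe_nnreal, ENNReal.ofReal_rpow_of_nonneg (NNReal.coe_nonneg _) (by norm_num)]
    have e2 : ∀ Z : ℝ, (2 : ℝ≥0∞) * ENNReal.ofReal Z = ENNReal.ofReal (2 * Z) := fun Z => by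
      rw [ENNReal.ofReal_mul (by norm_num : (0 : ℝ) ≤ 2), ENNReal.ofReal_ofNat]
    have hT1 : (CN : ℝ≥0∞) ^ (2 : ℝ) * (∫⁻ y in ball x₀ (2 * (r + 1)), ‖v s y‖ₑ ^ (4 : ℕ)) ≤
        ENNReal.ofReal ((CN : ℝ) ^ (2 : ℝ) * (M ^ 4 * (64 * r ^ 3))) * V₁ := by
      rw [ENNReal.ofReal_mul (by positivity), ← eCN, mul_assoc]
      gcongr
    have hT2 : volume (ball x₀ r) * (ENNReal.ofReal (CK * (r + 1)) *
        ∫⁻ y in (ball x₀ (2 * (r + 1)))ᶜ, ‖v s y‖ₑ ^ (2 : ℕ) * RieszKernel.powKer 4 (y - x₀)) ^ (2 : ℝ) ≤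
        ENNReal.ofReal (r ^ 3 * ((CK * I₁ / 2) ^ (2 : ℝ) * M ^ 4)) * V₁ := by
      rw [hVr]
      calc ENNReal.ofReal (r ^ 3) * V₁ * (ENNReal.ofReal (CK * (r + 1)) *
            ∫⁻ y in (ball x₀ (2 * (r + 1)))ᶜ, ‖v s y‖ₑ ^ (2 : ℕ) * RieszKernel.powKer 4 (y - x₀)) ^ (2 : ℝ)
          ≤ ENNReal.ofReal (r ^ 3) * V₁ * ENNReal.ofReal ((CK * I₁ / 2) ^ (2 : ℝ) * M ^ 4) := by gcongr
        _ = ENNReal.ofReal (r ^ 3 * ((CK * I₁ / 2) ^ (2 : ℝ) * M ^ 4)) * V₁ := by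
            rw [ENNReal.ofReal_mul (by positivity : (0 : ℝ) ≤ r ^ 3)]; ring
    calc (2 : ℝ≥0∞) * ((CN : ℝ≥0∞) ^ (2 : ℝ) * (∫⁻ y in ball x₀ (2 * (r + 1)), ‖v s y‖ₑ ^ (4 : ℕ)) +
          volume (ball x₀ r) * (ENNReal.ofReal (CK * (r + 1)) *
            ∫⁻ y in (ball x₀ (2 * (r + 1)))ᶜ, ‖v s y‖ₑ ^ (2 : ℕ) * RieszKernel.powKer 4 (y - x₀)) ^ (2 : ℝ))
        ≤ (2 : ℝ≥0∞) *
          (ENNReal.ofReal ((CN : ℝ) ^ (2 : ℝ) * (M ^ 4 * (64 * r ^ 3))) * V₁ +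
            ENNReal.ofReal (r ^ 3 * ((CK * I₁ / 2) ^ (2 : ℝ) * M ^ 4)) * V₁) := by
          gcongr
      _ = ENNReal.ofReal (K₁ * M ^ 4 * volume.real (ball x₀ r)) := by
          have hR : ENNReal.ofReal (K₁ * M ^ 4 * volume.real (ball x₀ r)) =
              ENNReal.ofReal (K₁ * M ^ 4 * r ^ 3) * V₁ := by
            rw [hVreal, show (K₁ * M ^ 4 * (r ^ 3 * V₁.toReal)) = (K₁ * M ^ 4 * r ^ 3) * V₁.toReal by ring,
              ENNReal.ofReal_mul (by positivity), ENNReal.ofReal_toReal hV₁top]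
          rw [hR, ← add_mul, ← ENNReal.ofReal_add (by positivity) (by positivity), ← mul_assoc, e2]
          congr 2
          rw [hK₁]
          ring
  -- the real form on the closed ball
  have hreal := setIntegral_rpow_two_le_of_lintegral_rpow_le (hpc.sub continuous_const) x₀ (by positivity) h32
  refine hreal.trans (le_of_eq ?_)
  congr 1
  -- `K₁ M⁴ = (K₁^{1/2} · C²/(−s))²`
  have hM4 : M ^ 4 = (C ^ 2 / (-s)) ^ (2 : ℝ) := by
    rw [← hM2, show ((M ^ 2) ^ (2 : ℝ) : ℝ) = (M ^ 2) ^ (2 : ℕ) by norm_cast]; ring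
  have hK12 : (K₁ ^ (1 / 2 : ℝ)) ^ (2 : ℝ) = K₁ := by
    rw [← Real.rpow_mul hK₁0]; norm_num
  rw [hM4, mul_div_assoc, Real.mul_rpow (by positivity) (by positivity), hK12]

end Summit.NavierStokesRegularity.NavierStokesRegularity.Theorems.PoloidalWindowDoorPoloidalWindowRigidityLargeScaleEnergyPressureTwo

end
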